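import Literature.RepresentationTheory.KonnoKonno2007.JunctionVacuumSectionLevi
import Literature.NumberTheory.Weil1964.ArchFollandCompact
import HarnessLib

/-!
# `KAK` implementer data over a finite set of places

The finite-dimensional bookkeeping that makes the Levi-family constructor
`KonnoKonno2007.JunctionVacuumSectionLevi.kakImplementerData_leviFamily` MULTIPLICATIVE OVER A FINITE INDEX SET `o`
("the real places"): if for every `v : o` a monoid `G v` acts on the phase space of `ℝ^ι` by `γ v` with Levi-family
`KAK` inputs (compact part through `μ₀ ∘ ιK v`, `A`-part a continuous family of dilations `L v t` with contragredients
`Ld v t` in a unitary frame `U v`, proper surjective word map `K v × P v × K v → G v`), then the product monoid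
`Π v, G v` acts on the phase space of `ℝ^{ι × o}` SLICE BY SLICE (`placePhase`), and its Levi-family inputs are the
place-blocks: frame `placeBlock U` (`ArchFollandCompact.placeBlock`, Mathlib `Matrix.blockDiagonal`), dilations
`placeLin (fun v => L v (t v))`, compact part `placeBlock ∘ (ιK v)_v`, word map = the product of the word maps (proper by
Mathlib `IsProperMap.pi_map`, onto by `Function.Surjective.piMap`).  The output is
`ArchVacuumSection.KAKImplementerData` on `𝓢(ℝ^{ι × o})` with operators
`μ₀(placeBlock U)⁻¹ ∘ leviS (placeLin …) ∘ μ₀(placeBlock U)`; no tensor product of Schwartz operators is formed, and the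
number of places is an arbitrary finite type (not a numeral), which is what the archimedean group
`Π_{v real} (U(V_v) × U(W_v))` of a unitary dual pair over a totally real field requires.  The slice convention
`(i, v) ↦ x (i, v)` is the one of `ArchFollandCompact.realify_placeBlock_fst` and of `placeVec`.

Also recorded: the Levi-input identity of a TRIVIAL `A`-part (`hγA` with `L = Ld = 1`, any frame), for the places where
the group is compact.

All statements are kernel-proved; no cited statement enters as a hypothesis.

References: G. B. Folland, Harmonic Analysis in Phase Space, Princeton UP 1989, §4.2 (4.24) p. 156, Prop. (4.39)
(metaplectic operators of the Levi factor and of `U(n)`); A. W. Knapp, Lie Groups Beyond an Introduction, 2nd ed.,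
Birkhäuser 2002, Thm 7.39 (`G = KAK`); A. Weil, Sur certains groupes d'opérateurs unitaires, Acta Math. 111 (1964),
no. 38 p. 194 (the adelic group as a restricted product over places; here only the finitely many real places enter).
-/

noncomputable section

open MeasureTheory Complex SchwartzMap Matrix
open scoped InnerProductSpace ComplexConjugate Real

namespace Literature.NumberTheory.Weil1964

open Literature.Analysis.SegalBargmann Literature.RepresentationTheory.HeisenbergGroup
open Literature.RepresentationTheory.KonnoKonno2007

variable {ι : Type} [Fintype ι] [DecidableEq ι] {o : Type} [Fintype o] [DecidableEq o]

local notation "PV" σ => (σ → ℝ) × (σ → ℝ)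

/-! ## 1. Slice-by-slice phase maps, dilations and frames on `ℝ^{ι × o}` -/

section Slices

/-- The phase-space map of `ℝ^{ι × o}` acting on the slice `{(·, v)}` by `γ v`, for every place `v`. [folklore] -/
def placePhase (γ : o → PhaseMap ι) : PhaseMap (ι × o) := fun pq =>
  (fun k => (γ k.2 (fun j => pq.1 (j, k.2), fun j => pq.2 (j, k.2))).1 k.1,
    fun k => (γ k.2 (fun j => pq.1 (j, k.2), fun j => pq.2 (j, k.2))).2 k.1)

omit [Fintype ι] [DecidableEq ι] [Fintype o] [DecidableEq o] in
/-- the first component of `placePhase γ` on the slice `v`. [folklore] -/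
theorem placePhase_fst (γ : o → PhaseMap ι) (pq : PV (ι × o)) (i : ι) (v : o) :
    (placePhase γ pq).1 (i, v) = (γ v (fun j => pq.1 (j, v), fun j => pq.2 (j, v))).1 i := rfl

omit [Fintype ι] [DecidableEq ι] [Fintype o] [DecidableEq o] in
/-- the second component of `placePhase γ` on the slice `v`. [folklore] -/
theorem placePhase_snd (γ : o → PhaseMap ι) (pq : PV (ι × o)) (i : ι) (v : o) :
    (placePhase γ pq).2 (i, v) = (γ v (fun j => pq.1 (j, v), fun j => pq.2 (j, v))).2 i := rfl

omit [Fintype ι] [DecidableEq ι] [Fintype o] [DecidableEq o] in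
/-- `placePhase` is functorial. [folklore] -/
theorem placePhase_comp (γ γ' : o → PhaseMap ι) :
    placePhase (fun v => γ v ∘ γ' v) = placePhase γ ∘ placePhase γ' := by
  funext pq
  rfl

omit [Fintype ι] [DecidableEq ι] [Fintype o] [DecidableEq o] in
/-- `placePhase (fun _ => id) = id`. [folklore] -/
theorem placePhase_id : placePhase (fun _ : o => (id : PhaseMap ι)) = id := by
  funext pq
  rfl

/-- The linear automorphism of `ℝ^{ι × o}` acting on the slice `{(·, v)}` by `L v`. [folklore] -/
def placeLin (L : o → ((ι → ℝ) ≃ₗ[ℝ] (ι → ℝ))) : (ι × o → ℝ) ≃ₗ[ℝ] (ι × o → ℝ) where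
  toFun x := fun k => L k.2 (fun j => x (j, k.2)) k.1
  invFun x := fun k => (L k.2).symm (fun j => x (j, k.2)) k.1
  map_add' x y := by
    funext k
    change L k.2 ((fun j => x (j, k.2)) + fun j => y (j, k.2)) k.1 = _
    rw [map_add]
    rfl
  map_smul' c x := by
    funext k
    change L k.2 (c • fun j => x (j, k.2)) k.1 = _
    rw [map_smul]
    rfl
  left_inv x := by
    funext k
    change (L k.2).symm (L k.2 fun j => x (j, k.2)) k.1 = _
    rw [LinearEquiv.symm_apply_apply]
  right_inv x := by
    funext k
    change L k.2 ((L k.2).symm fun j => x (j, k.2)) k.1 = _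
    rw [LinearEquiv.apply_symm_apply]

omit [Fintype ι] [DecidableEq ι] [Fintype o] [DecidableEq o] in
/-- unfolding `placeLin`. [folklore] -/
theorem placeLin_apply (L : o → ((ι → ℝ) ≃ₗ[ℝ] (ι → ℝ))) (x : ι × o → ℝ) (k : ι × o) :
    placeLin L x k = L k.2 (fun j => x (j, k.2)) k.1 := rfl

omit [Fintype ι] [DecidableEq ι] [Fintype o] [DecidableEq o] in
/-- `(placeLin L)⁻¹ = placeLin (L⁻¹)`. [folklore] -/
theorem placeLin_symm (L : o → ((ι → ℝ) ≃ₗ[ℝ] (ι → ℝ))) :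
    (placeLin L).symm = placeLin fun v => (L v).symm :=
  LinearEquiv.ext fun _ => rfl

omit [DecidableEq ι] [DecidableEq o] in
/-- contragredience is slicewise. [folklore] -/
theorem placeLin_dotProduct {L Ld : o → ((ι → ℝ) ≃ₗ[ℝ] (ι → ℝ))}
    (h : ∀ v (x y : ι → ℝ), L v x ⬝ᵥ Ld v y = x ⬝ᵥ y) (x y : ι × o → ℝ) :
    placeLin L x ⬝ᵥ placeLin Ld y = x ⬝ᵥ y := by
  simp only [dotProduct, Fintype.sum_prod_type_right]
  exact Finset.sum_congr rfl fun v _ => h v (fun j => x (j, v)) (fun j => y (j, v))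

omit [Fintype ι] [DecidableEq ι] [Fintype o] [DecidableEq o] in
/-- The Levi phase map of `placeLin` is the slicewise Levi phase map. [folklore] -/
theorem leviPhase_placeLin (L Ld : o → ((ι → ℝ) ≃ₗ[ℝ] (ι → ℝ))) :
    leviPhase (placeLin L) (placeLin Ld) = placePhase fun v => leviPhase (L v) (Ld v) := by
  funext pq
  rfl

/-- `realify (placeBlock U)` is the slicewise `realify`. [folklore] -/
theorem realify_placeBlock (U : o → Matrix.unitaryGroup ι ℂ) :
    realify (placeBlock U) = placePhase fun v => realify (U v) := by
  funext pq
  refine Prod.ext (funext fun k => ?_) (funext fun k => ?_)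
  · exact realify_placeBlock_fst U pq k.1 k.2
  · exact realify_placeBlock_snd U pq k.1 k.2

/-- `placeBlock` as a monoid homomorphism `U(ι)^o → U(ι × o)`. [folklore] -/
def placeBlockHom : (o → Matrix.unitaryGroup ι ℂ) →* Matrix.unitaryGroup (ι × o) ℂ where
  toFun := placeBlock
  map_one' := Subtype.ext (by
    change Matrix.blockDiagonal (fun v => (((1 : o → Matrix.unitaryGroup ι ℂ) v : Matrix.unitaryGroup ι ℂ) :
      Matrix ι ι ℂ)) = 1
    exact Matrix.blockDiagonal_one)
  map_mul' U U' := Subtype.ext (by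
    change Matrix.blockDiagonal (fun v => (((U * U') v : Matrix.unitaryGroup ι ℂ) : Matrix ι ι ℂ)) =
      Matrix.blockDiagonal (fun v => ((U v : Matrix.unitaryGroup ι ℂ) : Matrix ι ι ℂ)) *
        Matrix.blockDiagonal (fun v => ((U' v : Matrix.unitaryGroup ι ℂ) : Matrix ι ι ℂ))
    rw [← Matrix.blockDiagonal_mul]
    rfl)

/-- unfolding `placeBlockHom`. [folklore] -/
@[simp] theorem placeBlockHom_apply (U : o → Matrix.unitaryGroup ι ℂ) : placeBlockHom U = placeBlock U := rfl

/-- `(placeBlock U)⁻¹ = placeBlock U⁻¹`. [folklore] -/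
theorem placeBlock_inv (U : o → Matrix.unitaryGroup ι ℂ) : (placeBlock U)⁻¹ = placeBlock fun v => (U v)⁻¹ := by
  rw [← placeBlockHom_apply, ← map_inv]
  rfl

/-- `placeBlock` is continuous. [folklore] -/
theorem continuous_placeBlock :
    Continuous (placeBlock : (o → Matrix.unitaryGroup ι ℂ) → Matrix.unitaryGroup (ι × o) ℂ) :=
  Continuous.subtype_mk (Continuous.matrix_blockDiagonal
    (continuous_pi fun v => continuous_subtype_val.comp (continuous_apply v))) _

omit [DecidableEq ι] [DecidableEq o] in
/-- **Operator-norm continuity of slicewise dilations** (finite dimension: strong continuity suffices).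
[folklore] -/
theorem continuous_placeLin_symm {X : Type*} [TopologicalSpace X] {L : X → o → ((ι → ℝ) ≃ₗ[ℝ] (ι → ℝ))}
    (h : ∀ v, Continuous fun t => (((L t v).symm.toContinuousLinearEquiv : (ι → ℝ) ≃L[ℝ] (ι → ℝ)) :
      (ι → ℝ) →L[ℝ] (ι → ℝ))) :
    Continuous fun t => (((placeLin (L t)).symm.toContinuousLinearEquiv :
      (ι × o → ℝ) ≃L[ℝ] (ι × o → ℝ)) : (ι × o → ℝ) →L[ℝ] (ι × o → ℝ)) := by
  refine continuous_clm_apply.2 fun y => continuous_pi fun k => ?_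
  change Continuous ((fun f : ι → ℝ => f k.1) ∘ fun t =>
    (((L t k.2).symm.toContinuousLinearEquiv : (ι → ℝ) ≃L[ℝ] (ι → ℝ)) : (ι → ℝ) →L[ℝ] (ι → ℝ))
      fun j => y (j, k.2))
  exact (continuous_apply k.1).comp (continuous_clm_apply.1 (h k.2) fun j => y (j, k.2))

/-- **The Levi input of a trivial `A`-part**: `γ 1 = μ(U)⁻¹-conjugate of the Levi phase map of `(1, 1)`, in any frame
`U`. [folklore] -/
theorem leviInput_one {G : Type*} [Monoid G] {γ : G → PhaseMap ι} (hone : ∀ pq, γ 1 pq = pq)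
    (U : Matrix.unitaryGroup ι ℂ) (pq : PV ι) :
    γ 1 pq = realify U⁻¹ (leviPhase (LinearEquiv.refl ℝ (ι → ℝ)) (LinearEquiv.refl ℝ (ι → ℝ)) (realify U pq)) := by
  rw [hone, leviPhase_apply, LinearEquiv.refl_apply, LinearEquiv.refl_apply, Prod.mk.eta, ← realify_mul,
    inv_mul_cancel, Literature.Analysis.SegalBargmann.realify_one]

end Slices

/-! ## 2. Word maps of a product over places -/

section Word

variable {G : o → Type*} [∀ v, Monoid (G v)] [∀ v, TopologicalSpace (G v)]
  {K P : o → Type*} [∀ v, TopologicalSpace (K v)] [∀ v, TopologicalSpace (P v)]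

/-- The shuffle `((k_v), (t_v), (k'_v)) ↦ ((k_v, t_v, k'_v))_v`. [folklore] -/
def wordShufflePi (K P : o → Type*) [∀ v, TopologicalSpace (K v)] [∀ v, TopologicalSpace (P v)] :
    (∀ v, K v) × (∀ v, P v) × (∀ v, K v) ≃ₜ (∀ v, K v × P v × K v) where
  toFun x v := (x.1 v, x.2.1 v, x.2.2 v)
  invFun y := (fun v => (y v).1, fun v => (y v).2.1, fun v => (y v).2.2)
  left_inv _ := rfl
  right_inv _ := rfl
  continuous_toFun := continuous_pi fun v => ((continuous_apply v).comp continuous_fst).prodMk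
    (((continuous_apply v).comp (continuous_fst.comp continuous_snd)).prodMk
      ((continuous_apply v).comp (continuous_snd.comp continuous_snd)))
  continuous_invFun := (continuous_pi fun v => continuous_fst.comp (continuous_apply v)).prodMk
    ((continuous_pi fun v => continuous_fst.comp (continuous_snd.comp (continuous_apply v))).prodMk
      (continuous_pi fun v => continuous_snd.comp (continuous_snd.comp (continuous_apply v))))

omit [Fintype o] [DecidableEq o] [∀ v, TopologicalSpace (G v)] in
/-- The word map of the product is the product of the word maps, up to the shuffle. [folklore] -/
theorem word_places_eq (κ : ∀ v, K v → G v) (a : ∀ v, P v → G v) :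
    (fun p : (∀ v, K v) × (∀ v, P v) × (∀ v, K v) =>
        ((fun v => κ v (p.1 v)) * (fun v => a v (p.2.1 v)) * fun v => κ v (p.2.2 v) : ∀ v, G v)) =
      (fun y : ∀ v, K v × P v × K v => fun v => κ v (y v).1 * a v (y v).2.1 * κ v (y v).2.2) ∘
        wordShufflePi K P := by
  funext p
  rfl

omit [Fintype o] [DecidableEq o] in
/-- **Properness of the product word map** (Mathlib `IsProperMap.pi_map`). [folklore] -/
theorem isProperMap_word_places {κ : ∀ v, K v → G v} {a : ∀ v, P v → G v}
    (h : ∀ v, IsProperMap fun p : K v × P v × K v => κ v p.1 * a v p.2.1 * κ v p.2.2) :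
    IsProperMap fun p : (∀ v, K v) × (∀ v, P v) × (∀ v, K v) =>
      ((fun v => κ v (p.1 v)) * (fun v => a v (p.2.1 v)) * fun v => κ v (p.2.2 v) : ∀ v, G v) := by
  rw [word_places_eq]
  exact (IsProperMap.pi_map (f := fun v (p : K v × P v × K v) => κ v p.1 * a v p.2.1 * κ v p.2.2) h).comp
    (wordShufflePi K P).isProperMap

omit [Fintype o] [DecidableEq o] [∀ v, TopologicalSpace (G v)] in
/-- **Surjectivity of the product word map** (Mathlib `Function.Surjective.piMap`). [folklore] -/
theorem surjective_word_places {κ : ∀ v, K v → G v} {a : ∀ v, P v → G v}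
    (h : ∀ v, Function.Surjective fun p : K v × P v × K v => κ v p.1 * a v p.2.1 * κ v p.2.2) :
    Function.Surjective fun p : (∀ v, K v) × (∀ v, P v) × (∀ v, K v) =>
      ((fun v => κ v (p.1 v)) * (fun v => a v (p.2.1 v)) * fun v => κ v (p.2.2 v) : ∀ v, G v) := by
  rw [word_places_eq]
  exact (Function.Surjective.piMap (f := fun v (p : K v × P v × K v) => κ v p.1 * a v p.2.1 * κ v p.2.2) h).comp
    (wordShufflePi K P).surjective

end Word

/-! ## 3. The constructor over places -/

section Places

variable {G : o → Type*} [∀ v, Monoid (G v)] [∀ v, TopologicalSpace (G v)]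
  {K P : o → Type*} [∀ v, TopologicalSpace (K v)] [∀ v, TopologicalSpace (P v)]

/-- **`KAK` implementer data of `Π v, G v` on `𝓢(ℝ^{ι × o})` from Levi-family inputs at every place.**
For each place `v`: a phase action `γ v` of `G v` on `ℝ^ι × ℝ^ι` (multiplicative), compact generators `κ v` acting
by `realify (ιK v k)`, an `A`-part `a v` acting by the `U v`-conjugate of the Levi phase map of the dilations
`L v t` / contragredients `Ld v t` (operator-norm continuous in `t`), and a proper surjective word map.  Output: the
vacuum-normalisable `KAK` data of the product, slice by slice, with operators `μ₀(placeBlock (ιK · (k ·)))` and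
`μ₀(placeBlock U)⁻¹ ∘ leviS (placeLin (L · (t ·))) ∘ μ₀(placeBlock U)`.
[cite: Folland1989, §4.2 (4.24), Prop. (4.39); Knapp2002, Thm 7.39] -/
theorem kakImplementerData_leviFamily_places
    {γ : ∀ v, G v → PhaseMap ι} (hγ : ∀ v g g' pq, γ v (g * g') pq = γ v g (γ v g' pq))
    {κ : ∀ v, K v → G v} (ιK : ∀ v, K v → Matrix.unitaryGroup ι ℂ) (hιK : ∀ v, Continuous (ιK v))
    (hreal : ∀ v k pq, γ v (κ v k) pq = realify (ιK v k) pq) {a : ∀ v, P v → G v}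
    (U : o → Matrix.unitaryGroup ι ℂ) {L Ld : ∀ v, P v → ((ι → ℝ) ≃ₗ[ℝ] (ι → ℝ))}
    (had : ∀ v t (x y : ι → ℝ), L v t x ⬝ᵥ Ld v t y = x ⬝ᵥ y)
    (hL : ∀ v, Continuous fun t => (((L v t).symm.toContinuousLinearEquiv : (ι → ℝ) ≃L[ℝ] (ι → ℝ)) :
      (ι → ℝ) →L[ℝ] (ι → ℝ)))
    (hγA : ∀ v t pq, γ v (a v t) pq = realify (U v)⁻¹ (leviPhase (L v t) (Ld v t) (realify (U v) pq)))
    (hm : ∀ v, IsProperMap fun p : K v × P v × K v => κ v p.1 * a v p.2.1 * κ v p.2.2)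
    (hsurj : ∀ v, Function.Surjective fun p : K v × P v × K v => κ v p.1 * a v p.2.1 * κ v p.2.2) :
    KAKImplementerData (fun g : ∀ v, G v => placePhase fun v => γ v (g v))
      (fun k : ∀ v, K v => fun v => κ v (k v)) (fun t : ∀ v, P v => fun v => a v (t v))
      (fun k => unitaryOpPi (placeBlock fun v => ιK v (k v)))
      (fun t => (unitaryOpPi (placeBlock U)⁻¹).comp
        ((leviS (placeLin fun v => L v (t v))).comp (unitaryOpPi (placeBlock U)))) := by
  refine kakImplementerData_leviFamily (γ := fun g : ∀ v, G v => placePhase fun v => γ v (g v))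
    (κ := fun k : ∀ v, K v => fun v => κ v (k v)) (a := fun t : ∀ v, P v => fun v => a v (t v))
    (L := fun t : ∀ v, P v => placeLin fun v => L v (t v)) (Ld := fun t : ∀ v, P v => placeLin fun v => Ld v (t v))
    ?_ (fun k => placeBlock fun v => ιK v (k v)) ?_ ?_ (placeBlock U) ?_ ?_ ?_ ?_ ?_
  · intro g g' pq
    have h : (fun v => γ v (g v * g' v)) = fun v => γ v (g v) ∘ γ v (g' v) :=
      funext fun v => funext (hγ v (g v) (g' v))
    simp only [Pi.mul_apply, h, placePhase_comp, Function.comp_apply]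
  · exact continuous_placeBlock.comp (continuous_pi fun v => (hιK v).comp (continuous_apply v))
  · intro k pq
    have h : (fun v => γ v (κ v (k v))) = fun v => realify (ιK v (k v)) := funext fun v => funext (hreal v (k v))
    simp only [h, realify_placeBlock]
  · exact fun t x y => placeLin_dotProduct (fun v => had v (t v)) x y
  · exact continuous_placeLin_symm fun v => (hL v).comp (continuous_apply v)
  · intro t pq
    have h : (fun v => γ v (a v (t v))) =
        fun v => realify (U v)⁻¹ ∘ leviPhase (L v (t v)) (Ld v (t v)) ∘ realify (U v) :=
      funext fun v => funext (hγA v (t v))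
    simp only [h, placeBlock_inv, realify_placeBlock, leviPhase_placeLin, placePhase_comp, Function.comp_apply]
  · exact isProperMap_word_places hm
  · exact surjective_word_places hsurj

end Places

end Literature.NumberTheory.Weil1964

end
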